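import Summits.Ventures.PackingBounds.ThreePointCert.C9TCert

/-!
# A(9, arccos 1/3) ≤ 99 (three-point bound, kernel-checked): kernel validation of Gram block R1 (chunks 1–3 of 3)

Framing: lottery ticket; floor = certified bounds/negative ranges. Venture `PackingBounds` (cell
`pub-packcert`), three-point SDP family. Integer data of a feasible point of the Bachoc–Vallentin
semidefinite program (n = 9, s = 1/3, degree d = 8, symmetric
sums of squares), derived by `pub-packcert-sdp/code/cert2lean.py` from the exact rational
certificate `sdp-n9-d8-s1-3-sym.json` of the cell (two independent exact verifiers + referee), in the
units of the kernel checker `ThreePointCert.Check` (soundness `ThreePointCert.Sound`). Generated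
file: plain lists of integers / monomials.
-/

namespace Summit.Ventures.PackingBounds.ThreePointCert.C9T

open Literature.Geometry.DiscreteGeometry Literature.Geometry.DiscreteGeometry.PolyCert PolyCert.SPoly

set_option maxHeartbeats 0 in
/-- Block `R1`: rows from 0 (62 rows) of `zᵀ(LLᵀ)z` added to `[]` give `dR1c1` (kernel). -/
theorem okR1_1 : chunkOK gR1 0 62 [] dR1c1 = true := by
  decide +kernel

set_option maxHeartbeats 0 in
/-- Block `R1`: rows from 62 (31 rows) of `zᵀ(LLᵀ)z` added to `dR1c1` give `dR1c2` (kernel). -/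
theorem okR1_2 : chunkOK gR1 62 31 dR1c1 dR1c2 = true := by
  decide +kernel

set_option maxHeartbeats 0 in
/-- Block `R1`: rows from 93 ((gR1.z.length - 93) rows) of `zᵀ(LLᵀ)z` added to `dR1c2` give `eR1` (kernel). -/
theorem okR1_3 : chunkOK gR1 93 (gR1.z.length - 93) dR1c2 eR1 = true := by
  decide +kernel

end Summit.Ventures.PackingBounds.ThreePointCert.C9T
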